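import Summits.BirchSwinnertonDyer.BirchSwinnertonDyer.Theses.UniversalToricDescent
import Summits.BirchSwinnertonDyer.BirchSwinnertonDyer.Theorems.UniversalToricDescentRoadFFDescentOddRational
import Summits.BirchSwinnertonDyer.BirchSwinnertonDyer.Theorems.UniversalToricDescentTwinTorsionRankOne
import Summits.BirchSwinnertonDyer.BirchSwinnertonDyer.Theorems.UniversalToricDescentTwinDecLocusCubeTest
import HarnessLib

/-!
# ACT G — LINE-LEVEL PAYOFF (width seat bsd-wall-utd-p2-w2 g3, 2026-08-28): line `membertower_TD` for the PROPOSED doubly-conditional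
# twin crux ♭B_TD (= ♭B 26062 with the rational Wan clause owed only under «`X^∅_ac(W′)` torsion» (act F) AND «(dec) `W′(ℚ₃)[3] = 0`»
# (act G)) closes from ONE research stub — `stub_memberTowerMult` (v7/v4 VERBATIM) — with `stub_torsionMult` AND
# `stub_wanFrameMultCube` GONE

Why the kernel can hand the line both binders on a (iv)-good class: torsion by act F (`UniversalToricDescentDefectPTSqueeze`,
p619020: ♭T′ + wall + p611201); (dec) by act G (`UniversalToricDescentTwinCubeLocusOfCell.twin_dec_of_cell_dec`: (dec) for the twin
⟺ (iv) `E(ℚ₃)[3] = 0` for the cell curve, utd-p1 g5's `baseChange_noThreeTorsion_iff_of_modPCongruent`). On (iv)-bad classes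
every multiplicative twin is a cube twin (`twin_cube_iff_cell_threeTorsion`) and `stub_wanFrameMultCube` remains the Wan side.
`lean check`: rc 0, sorries = 1 = `stub_memberTowerMult`. NOT registered by this seat (♭B_TD is a proposed text, not a route
decl). BSD is not proved by any of this; the `sorry` below is LEAD g11's registered research stub (promote-stub).
-/

noncomputable section

open scoped Classical

set_option linter.dupNamespace false
set_option autoImplicit false

namespace Summit.BirchSwinnertonDyer.BirchSwinnertonDyer.Cruxes.TwinWanFrameAtThreeMult.MemberTowerTD

open PowerSeries WeierstrassCurve NumberField IsDedekindDomain Field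
  Literature.NumberTheory.EllipticCurves
  Literature.NumberTheory.EllipticCurves.ModularForms
  Literature.NumberTheory.EllipticCurves.Rank1Residual
  Literature.NumberTheory.EllipticCurves.BigGaloisRep
  Literature.NumberTheory.EllipticCurves.GreenbergSelmer
  Literature.NumberTheory.GaloisRepresentations
  Summit.BirchSwinnertonDyer.Rank1Residual.X11b
  Summit.BirchSwinnertonDyer.Rank1Residual.X11b.Halves
  Summit.BirchSwinnertonDyer.BirchSwinnertonDyer.Theorems.SchneiderFree
  Summit.BirchSwinnertonDyer.BirchSwinnertonDyer.Theorems.UniversalToricDescentTwinTorsionRankOne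
  Summit.BirchSwinnertonDyer.BirchSwinnertonDyer.Theorems.UniversalToricDescentTwinDecLocus

/-- STUB (= v7/v4 `stub_memberTowerMult` VERBATIM — THE RATIONAL, `m`-UNIFORM HIDA MEMBER TOWER AT THE 3-MULTIPLICATIVE TWIN,
RESEARCH «beyond print», promote-stub by LEAD g11). [cite: Skinner2016PacificMC, §2.6 (2-6-1), §3.1 (a)(b)(c) (p. 192)]
[cite: Castella2020JIMJ, §2.5, Thm. 2.11] [cite: YanZhu2026, Thm. 4.4, Rem. 4.5, Cor. 4.6 (arXiv:2412.20078 pp. 10–11)] -/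
theorem stub_memberTowerMult :
    ∀ (W' : WeierstrassCurve ℚ) [W'.IsElliptic] [W'.IsGloballyMinimal] (N' : ℕ) [NeZero N']
      (K : Type) [Field K] [NumberField K] (Dt' : ModularParametrizationData W' N'),
      Mult W' 3 → W'.HasSurjectiveModNGaloisRep 3 → W'.conductorNorm ℤ = N' → IsImaginaryQuadratic K →
      SatisfiesHeegnerHypothesis N' K → Odd (NumberField.discr K) →
      ∀ (κ : ZpExtension K 3), κ.IsAnticyclotomic → ∀ (γ : absoluteGaloisGroup K) [Fact (κ.IsTopGenerator γ)]
        (𝔭 : HeightOneSpectrum (𝓞 K)), ((3 : ℕ) : 𝓞 K) ∈ 𝔭.asIdeal →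
        𝔭.asIdeal.ramificationIdx (𝓞 ℚ) = 1 → 𝔭.asIdeal.inertiaDeg (𝓞 ℚ) = 1 →
        ∀ (𝔭' : HeightOneSpectrum (𝓞 K)), ((3 : ℕ) : 𝓞 K) ∈ 𝔭'.asIdeal → 𝔭' ≠ 𝔭 →
        ∀ (ι' : PadicAlgCl 3 ≃+* ℂ), BranchInducesPrime 3 ι' 𝔭 →
        ∃ (ΩK : ℂ) (Ωp : ℂ_[3]) (L : UnrSeries 3),
          ΩK ≠ 0 ∧ Ωp ≠ 0 ∧ IsBDPLFunction ι' 𝔭 κ γ Dt'.f ΩK Ωp L ∧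
          ∃ e : ℕ, ∀ m : ℕ, 1 ≤ m →
            ∃ D : Skinner2016.HidaCongruentMember W' 3 m,
              ∀ [TopologicalSpace (PowerSeries (padicCoeffIntegers D.ι))]
                [ContinuousSMul (PowerSeries (padicCoeffIntegers D.ι))
                  (BigRepModule (padicCoeffIntegers D.ι) 3 (Cofree D.Δ.ρ (padicCoeffField D.ι)))],
              ∀ (S₀ : Type) [CommRing S₀] (a : unrIntegers 3 →+* S₀) (b : padicCoeffIntegers D.ι →+* S₀)
                (j : ℤ_[3] →+* unrIntegers 3),
                (∀ x : ℤ_[3], ((j x : unrIntegers 3) : ℂ_[3]) = algebraMap ℚ_[3] ℂ_[3] (x : ℚ_[3])) →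
                a.comp j = b.comp (algebraMap ℤ_[3] (padicCoeffIntegers D.ι)) →
                ∃ Lm : PowerSeries S₀,
                  (Module.IsTorsion (PowerSeries (padicCoeffIntegers D.ι))
                      (XBig κ (D.Δ.cofreeRepOver K) 𝔭' (↑(W'.sigmaPlacesFinset 3 K))) →
                    Ideal.span {((3 : ℕ) : PowerSeries S₀) ^ e} *
                        (XBig.charIdeal κ (D.Δ.cofreeRepOver K) 𝔭' (↑(W'.sigmaPlacesFinset 3 K))).map
                          (PowerSeries.map b) ≤ Ideal.span {Lm}) ∧
                  Ideal.span {Lm} ≤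
                    Ideal.span {PowerSeries.map a (L * PowerSeries.map j (W'.sigmaEulerElement 3 K κ))} ⊔
                      Ideal.span {((3 : ℕ) : PowerSeries S₀) ^ m} := by
  sorry

/-- DERIVED (no sorry of its own): on the (dec) locus `W′(ℚ₃)[3] = 0`, the rational Wan clause AT A GIVEN FRAME `L` carrying a
rational `m`-uniform member tower, UNDER torsion of `X^∅_ac(W′/K_∞; slot 𝔭′)` — `Σ`-data from torsion
(`twin_sigmaDataAt_of_isTorsion_empty'`, p613967), Fitting-level descent (p616714), recombination (p612782); the two lines of
p616714's `twin_exists_wanFrame_of_sigmaData_of_rationalMemberTower`, kept at the same `L`.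
[cite: Skinner2016PacificMC, §3.1 (p. 192) (mechanism)] [cite: JetchevSkinnerWan2017, §5.1] -/
theorem wanClause_of_rationalMemberTower_of_isTorsion
    (W' : WeierstrassCurve ℚ) [W'.IsElliptic] [W'.IsGloballyMinimal] (N' : ℕ)
    (K : Type) [Field K] [NumberField K]
    (hm : Mult W' 3) (hsurj : W'.HasSurjectiveModNGaloisRep 3) (hN : W'.conductorNorm ℤ = N')
    (hK : IsImaginaryQuadratic K) (hH : SatisfiesHeegnerHypothesis N' K)
    (κ : ZpExtension K 3) (hκ : κ.IsAnticyclotomic) (γ : Field.absoluteGaloisGroup K) [Fact (κ.IsTopGenerator γ)]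
    (𝔭' : HeightOneSpectrum (𝓞 K)) (h𝔭' : ((3 : ℕ) : 𝓞 K) ∈ 𝔭'.asIdeal)
    (hiv : ∀ Q : (W'.baseChange ℚ_[3]).toAffine.Point, 3 • Q = 0 → Q = 0)
    (hT₀ : Module.IsTorsion (IwasawaAlgebra 3) (AcSelmer.XAc (W'.baseChange K) 3 κ 𝔭' ∅ γ))
    (L : UnrSeries 3) (e : ℕ)
    (hmem : ∀ m : ℕ, 1 ≤ m →
      ∃ D : Skinner2016.HidaCongruentMember W' 3 m,
        ∀ [TopologicalSpace (PowerSeries (padicCoeffIntegers D.ι))]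
          [ContinuousSMul (PowerSeries (padicCoeffIntegers D.ι))
            (BigRepModule (padicCoeffIntegers D.ι) 3 (Cofree D.Δ.ρ (padicCoeffField D.ι)))],
        ∀ (S₀ : Type) [CommRing S₀] (a : unrIntegers 3 →+* S₀) (b : padicCoeffIntegers D.ι →+* S₀)
          (j : ℤ_[3] →+* unrIntegers 3),
          (∀ x : ℤ_[3], ((j x : unrIntegers 3) : ℂ_[3]) = algebraMap ℚ_[3] ℂ_[3] (x : ℚ_[3])) →
          a.comp j = b.comp (algebraMap ℤ_[3] (padicCoeffIntegers D.ι)) →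
          ∃ Lm : PowerSeries S₀,
            (Module.IsTorsion (PowerSeries (padicCoeffIntegers D.ι))
                (XBig κ (D.Δ.cofreeRepOver K) 𝔭' (↑(W'.sigmaPlacesFinset 3 K))) →
              Ideal.span {((3 : ℕ) : PowerSeries S₀) ^ e} *
                  (XBig.charIdeal κ (D.Δ.cofreeRepOver K) 𝔭' (↑(W'.sigmaPlacesFinset 3 K))).map
                    (PowerSeries.map b) ≤ Ideal.span {Lm}) ∧
            Ideal.span {Lm} ≤
              Ideal.span {PowerSeries.map a (L * PowerSeries.map j (W'.sigmaEulerElement 3 K κ))} ⊔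
                Ideal.span {((3 : ℕ) : PowerSeries S₀) ^ m}) :
    ∀ G ∈ (AcSelmer.XAc.charIdeal (W'.baseChange K) 3 κ 𝔭' ∅ γ).map (PowerSeries.map (toUnr 3)),
      PowerSeries.C (((3 : ℕ) : unrIntegers 3) ^ e) * G ∈ Ideal.span {L} := by
  have hirr : Irr W' 3 := hasIrreducibleModPGaloisRep_of_hasSurjectiveModNGaloisRep W' 3 hsurj
  have hsp : SplitsIn K 3 := hH 3 Nat.prime_three (hN ▸ dvd_conductorNorm_of_mult hm)
  have key := P2.RoadFF.map_span_C_pow_mul_fittingIdeal_le_of_rationalMemberTower_odd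
    SkinnerUrban2014.prop323_XAc_equiv_XBigDecomp_holds W' 3 le_rfl K hK hirr hm hsp hiv κ hκ γ 𝔭' h𝔭' L e hmem
  obtain ⟨hSfin, hT, hPS, hX⟩ := twin_sigmaDataAt_of_isTorsion_empty' W' N' K hm hN hK hH κ hκ γ 𝔭' h𝔭' hT₀
  exact AcSelmer.XAc.forall_C_pow_mul_mem_span_of_map_span_mul_fittingIdeal_le (W'.baseChange K) 3 κ 𝔭' γ hSfin hT e
    key hPS hX (dvd_refl _)

/-- **♭B_TD FROM `stub_memberTowerMult` ALONE**: the PROPOSED doubly-conditional twin crux (♭B with its rational Wan clause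
owed under torsion of `X^∅_ac(W′)` AND (dec); text spelled out): the frame is the member tower's, the clause is
`wanClause_of_rationalMemberTower_of_isTorsion` fed the two hypotheses. No dichotomy, no cube stub, no torsion stub.
[cite: Skinner2016PacificMC, §3.1 (p. 192) (mechanism)] -/
theorem twinWanFrameAtThreeMultTD_of :
    ∀ (W' : WeierstrassCurve ℚ) [W'.IsElliptic] [W'.IsGloballyMinimal] (N' : ℕ) [NeZero N'] (K : Type) [Field K]
      [NumberField K] (Dt' : ModularParametrizationData W' N'),
      Mult W' 3 → W'.HasSurjectiveModNGaloisRep 3 → W'.conductorNorm ℤ = N' → IsImaginaryQuadratic K →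
      SatisfiesHeegnerHypothesis N' K → Odd (NumberField.discr K) →
      ∀ (κ : ZpExtension K 3), κ.IsAnticyclotomic → ∀ (γ : absoluteGaloisGroup K) [Fact (κ.IsTopGenerator γ)]
        (𝔭 : HeightOneSpectrum (𝓞 K)), ((3 : ℕ) : 𝓞 K) ∈ 𝔭.asIdeal →
        𝔭.asIdeal.ramificationIdx (𝓞 ℚ) = 1 → 𝔭.asIdeal.inertiaDeg (𝓞 ℚ) = 1 →
        ∀ (𝔭' : HeightOneSpectrum (𝓞 K)), ((3 : ℕ) : 𝓞 K) ∈ 𝔭'.asIdeal → 𝔭' ≠ 𝔭 →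
        ∀ (ι' : PadicAlgCl 3 ≃+* ℂ), BranchInducesPrime 3 ι' 𝔭 →
        ∃ (ΩK : ℂ) (Ωp : ℂ_[3]) (L : UnrSeries 3), ΩK ≠ 0 ∧ Ωp ≠ 0 ∧ IsBDPLFunction ι' 𝔭 κ γ Dt'.f ΩK Ωp L ∧
          (Module.IsTorsion (IwasawaAlgebra 3) (AcSelmer.XAc (W'.baseChange K) 3 κ 𝔭' ∅ γ) →
            (∀ Q : (W'.baseChange ℚ_[3]).toAffine.Point, 3 • Q = 0 → Q = 0) →
            ∃ k : ℕ, ∀ G ∈ (AcSelmer.XAc.charIdeal (W'.baseChange K) 3 κ 𝔭' ∅ γ).map (PowerSeries.map (toUnr 3)),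
              PowerSeries.C (((3 : ℕ) : unrIntegers 3) ^ k) * G ∈ Ideal.span {L}) := by
  intro W' _ _ N' _ K _ _ Dt' hmult hsurj hN' hK hH hodd κ hκ γ _ 𝔭 h𝔭 he hf 𝔭' h𝔭' hne ι' hι'
  obtain ⟨ΩK, Ωp, L, hΩ, hΩp, hL, e, hmem⟩ :=
    stub_memberTowerMult W' N' K Dt' hmult hsurj hN' hK hH hodd κ hκ γ 𝔭 h𝔭 he hf 𝔭' h𝔭' hne ι' hι'
  exact ⟨ΩK, Ωp, L, hΩ, hΩp, hL, fun hT₀ hdec ↦ ⟨e, wanClause_of_rationalMemberTower_of_isTorsion W' N' K hmult hsurj hN' hK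
    hH κ hκ γ 𝔭' h𝔭' hdec hT₀ L e hmem⟩⟩

end Summit.BirchSwinnertonDyer.BirchSwinnertonDyer.Cruxes.TwinWanFrameAtThreeMult.MemberTowerTD

end
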